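import Mathlib.Topology.Algebra.InfiniteSum.Constructions
import Mathlib.Topology.Algebra.InfiniteSum.ENNReal
import Summits.CriticalPhenomena.SAWScalingLimit.Theorems.SAWTotalPositivityBoundaryTP2Defs
import Summits.CriticalPhenomena.SAWScalingLimit.Theorems.SAWTotalPositivityBoundaryTP2Strip4RecPair201Aux
import Summits.CriticalPhenomena.SAWScalingLimit.Theorems.EdgeOfPositivity.Negative.EdgeOfPositivityRectDomain
import HarnessLib

/-!
# Crux `BoundaryTP2` (stmt-CriticalPhenomena-7115), line `Sketch`: width-4 pair recursion `(2; 0→1)`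

Tool stub `stub_strip4_recPair201` (W4-C3). On the width-4 strips
`S_L = discreteDomainGraph (rectDomain L 3) 1` (sites `{0..L} × {0,1,2,3}`, rows labelled by `ρ = id`
or by the mirror `j ↦ 3 - j`) the disjoint-pair kernel of `S_{L+1}` with main path
`γ : (0,r) → t = (L+1,ρ₂)` and loop `γ' : m₀ = (L+1,ρ₀) → m₁ = (L+1,ρ₁)` satisfies
`PP' = x² Z(ρ₂) + x³ Z(ρ₃) + x³ PP(ρ₂; ρ₀→ρ₁) + x⁴ PP(ρ₃; ρ₀→ρ₁)` over `S_L`.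
Proof: for a disjoint pair, the loop is the rung `m₀ m₁` or dips `m₀ (L,ρ₀) ⋯ (L,ρ₁) m₁` through
`S_L` (its last step cannot come from `t ∈ γ`, and `m₃ = (L+1,ρ₃)` would be a dead end); the main
path enters `t` from `(L,ρ₂)` or along `(L,ρ₃) m₃ t`, after a path of `S_L`. These gluings form an
injection whose range contains every disjoint pair (`s4p201_exists_glue`, file `…Strip4RecPair201Aux`,
for an abstract last column of a graph `G ≥ G₀`), and the sum is transported along it
(`s4p201_abstract`: `Function.Injective.tsum_eq`, `Summable.tsum_sum`). The strip instance is
coordinate bookkeeping on `Site 2` closed by `omega`, uniformly in the two row labellings.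
-/

noncomputable section

namespace Summit.CriticalPhenomena.SAWScalingLimit.Theorems.BoundaryTP2

open SimpleGraph Walk
open Literature.Probability.LatticeModels Literature.Probability.RandomPlanarGeometry
open Summit.CriticalPhenomena.SAWScalingLimit.Theorems.EdgeOfPositivity.Negative
open scoped ENNReal

variable {V : Type*}

open Classical in
/-- **The pair recursion, abstract form.** In the setting of `s4p201_exists_glue`, for `x ≥ 0`,
`Σ_{(γ,γ') disjoint} x^{|γ|+|γ'|} = x² Z_{G₀}(a,ps) + x³ Z_{G₀}(a,p3) + x³ PP_{G₀}(ps) + x⁴ PP_{G₀}(p3)`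
with `PP_{G₀}(c) = Σ_{(γ₀ : a → c, δ : p0 → p1) disjoint} x^{|γ₀|+|δ|}`: reparametrise the disjoint pairs
by the gluing map (`Function.Injective.tsum_eq`) and split the sum over the four classes. [folklore] -/
private theorem s4p201_abstract {G₀ G : SimpleGraph V} {a ps p3 p0 p1 t m0 m1 m3 : V} (x : ℝ)
    (hx : 0 ≤ x) (hle : G₀ ≤ G)
    (hold : ∀ u v, G.Adj u v → (u ≠ t ∧ u ≠ m0 ∧ u ≠ m1 ∧ u ≠ m3) →
      (v ≠ t ∧ v ≠ m0 ∧ v ≠ m1 ∧ v ≠ m3) → G₀.Adj u v)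
    (hG₀ : ∀ u v, G₀.Adj u v → v ≠ t ∧ v ≠ m0 ∧ v ≠ m1 ∧ v ≠ m3)
    (ha : a ≠ t ∧ a ≠ m0 ∧ a ≠ m1 ∧ a ≠ m3) (hp0 : p0 ≠ t ∧ p0 ≠ m0 ∧ p0 ≠ m1 ∧ p0 ≠ m3)
    (hps : ps ≠ m3) (hpt : G.Adj ps t) (hp3m3 : G.Adj p3 m3) (hm3t : G.Adj m3 t)
    (hm0m1 : G.Adj m0 m1) (hm0p0 : G.Adj m0 p0) (hp1m1 : G.Adj p1 m1)
    (hNt : ∀ u, G.Adj t u → u = ps ∨ u = m1 ∨ u = m3) (hNm3 : ∀ u, G.Adj m3 u → u = p3 ∨ u = t)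
    (hNm0 : ∀ u, G.Adj m0 u → u = p0 ∨ u = m1) (hNm1 : ∀ u, G.Adj m1 u → u = p1 ∨ u = m0 ∨ u = t)
    (ht0 : t ≠ m0) (ht1 : t ≠ m1) (h03 : m0 ≠ m3) (h13 : m1 ≠ m3) :
    (∑' (γ : G.Path a t) (γ' : G.Path m0 m1),
      (if List.Disjoint γ.1.support γ'.1.support then
        ENNReal.ofReal (x ^ γ.1.length) * ENNReal.ofReal (x ^ γ'.1.length) else 0)) =
      ENNReal.ofReal (x ^ 2) * pathKernel G₀ x a ps + ENNReal.ofReal (x ^ 3) * pathKernel G₀ x a p3 +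
        ENNReal.ofReal (x ^ 3) *
          (∑' (γ : G₀.Path a ps) (γ' : G₀.Path p0 p1),
            (if List.Disjoint γ.1.support γ'.1.support then
              ENNReal.ofReal (x ^ γ.1.length) * ENNReal.ofReal (x ^ γ'.1.length) else 0)) +
        ENNReal.ofReal (x ^ 4) *
          (∑' (γ : G₀.Path a p3) (γ' : G₀.Path p0 p1),
            (if List.Disjoint γ.1.support γ'.1.support then
              ENNReal.ofReal (x ^ γ.1.length) * ENNReal.ofReal (x ^ γ'.1.length) else 0)) := by
  obtain ⟨g, hinj, hrange, hA, hB, hAD, hBD⟩ := s4p201_exists_glue hle hold hG₀ ha hp0 hps hpt hp3m3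
    hm3t hm0m1 hm0p0 hp1m1 hNt hNm3 hNm0 hNm1 ht0 ht1 h03 h13
  -- the double sum as a sum over pairs, reparametrised by `g`
  have h1 : (∑' (γ : G.Path a t) (γ' : G.Path m0 m1),
      (if List.Disjoint γ.1.support γ'.1.support then
        ENNReal.ofReal (x ^ γ.1.length) * ENNReal.ofReal (x ^ γ'.1.length) else 0)) =
      ∑' s, (if List.Disjoint (g s).1.1.support (g s).2.1.support then
        ENNReal.ofReal (x ^ (g s).1.1.length) * ENNReal.ofReal (x ^ (g s).2.1.length) else 0) :=
    calc _ = ∑' q : G.Path a t × G.Path m0 m1, (if List.Disjoint q.1.1.support q.2.1.support then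
          ENNReal.ofReal (x ^ q.1.1.length) * ENNReal.ofReal (x ^ q.2.1.length) else 0) :=
        (ENNReal.tsum_prod (f := fun (γ : G.Path a t) (γ' : G.Path m0 m1) =>
          if List.Disjoint γ.1.support γ'.1.support then
            ENNReal.ofReal (x ^ γ.1.length) * ENNReal.ofReal (x ^ γ'.1.length) else 0)).symm
      _ = _ := by
        refine (hinj.tsum_eq (f := fun q : G.Path a t × G.Path m0 m1 =>
          if List.Disjoint q.1.1.support q.2.1.support then
            ENNReal.ofReal (x ^ q.1.1.length) * ENNReal.ofReal (x ^ q.2.1.length) else 0) ?_).symm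
        intro q hq
        rw [Function.mem_support] at hq
        refine hrange q ?_
        by_contra hd
        exact hq (if_neg hd)
  -- the weights on the four classes
  have h2 : ∀ γ₀ : G₀.Path a ps,
      (if List.Disjoint (g (Sum.inl (Sum.inl γ₀))).1.1.support (g (Sum.inl (Sum.inl γ₀))).2.1.support
        then ENNReal.ofReal (x ^ (g (Sum.inl (Sum.inl γ₀))).1.1.length) *
          ENNReal.ofReal (x ^ (g (Sum.inl (Sum.inl γ₀))).2.1.length) else 0) =
      ENNReal.ofReal (x ^ 2) * ENNReal.ofReal (x ^ γ₀.1.length) := fun γ₀ => by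
    obtain ⟨hd, hl1, hl2⟩ := hA γ₀
    rw [if_pos hd, hl1, hl2, ← ENNReal.ofReal_mul (pow_nonneg hx _),
      ← ENNReal.ofReal_mul (pow_nonneg hx _)]
    congr 1
    ring
  have h3 : ∀ γ₀ : G₀.Path a p3,
      (if List.Disjoint (g (Sum.inl (Sum.inr γ₀))).1.1.support (g (Sum.inl (Sum.inr γ₀))).2.1.support
        then ENNReal.ofReal (x ^ (g (Sum.inl (Sum.inr γ₀))).1.1.length) *
          ENNReal.ofReal (x ^ (g (Sum.inl (Sum.inr γ₀))).2.1.length) else 0) =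
      ENNReal.ofReal (x ^ 3) * ENNReal.ofReal (x ^ γ₀.1.length) := fun γ₀ => by
    obtain ⟨hd, hl1, hl2⟩ := hB γ₀
    rw [if_pos hd, hl1, hl2, ← ENNReal.ofReal_mul (pow_nonneg hx _),
      ← ENNReal.ofReal_mul (pow_nonneg hx _)]
    congr 1
    ring
  have h45 : ∀ (k e : ℕ) {c : V} (γ₀ : G₀.Path a c) (δ : G₀.Path p0 p1) (q : G.Path a t × G.Path m0 m1),
      (List.Disjoint q.1.1.support q.2.1.support ↔ List.Disjoint γ₀.1.support δ.1.support) →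
      q.1.1.length = γ₀.1.length + e → q.2.1.length = δ.1.length + 2 → k = e + 2 →
      (if List.Disjoint q.1.1.support q.2.1.support then
        ENNReal.ofReal (x ^ q.1.1.length) * ENNReal.ofReal (x ^ q.2.1.length) else 0) =
      ENNReal.ofReal (x ^ k) * (if List.Disjoint γ₀.1.support δ.1.support then
        ENNReal.ofReal (x ^ γ₀.1.length) * ENNReal.ofReal (x ^ δ.1.length) else 0) := by
    intro k e c γ₀ δ q hd hl1 hl2 hk
    by_cases h : List.Disjoint γ₀.1.support δ.1.support
    · rw [if_pos (hd.2 h), if_pos h, hl1, hl2, hk, ← ENNReal.ofReal_mul (pow_nonneg hx _),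
        ← ENNReal.ofReal_mul (pow_nonneg hx _), ← ENNReal.ofReal_mul (pow_nonneg hx _)]
      congr 1
      ring
    · rw [if_neg (fun h' => h (hd.1 h')), if_neg h, mul_zero]
  rw [h1, Summable.tsum_sum ENNReal.summable ENNReal.summable,
    Summable.tsum_sum ENNReal.summable ENNReal.summable, ENNReal.tsum_prod',
    Summable.tsum_sum ENNReal.summable ENNReal.summable, tsum_congr h2, tsum_congr h3,
    ENNReal.tsum_mul_left, ENNReal.tsum_mul_left,
    tsum_congr (fun γ₀ => tsum_congr fun δ => h45 3 1 γ₀ δ _ (hAD γ₀ δ).1 (hAD γ₀ δ).2.1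
      (hAD γ₀ δ).2.2 rfl),
    tsum_congr (fun γ₀ => tsum_congr fun δ => h45 4 2 γ₀ δ _ (hBD γ₀ δ).1 (hBD γ₀ δ).2.1
      (hBD γ₀ δ).2.2 rfl)]
  simp only [ENNReal.tsum_mul_left]
  rw [← add_assoc]
  rfl

/-! ## The strip instance -/

/-- Adjacency in `ℤ²` in coordinates. [folklore] -/
private theorem s4p201_zd_adj_iff (u v : Site 2) :
    (zdGraph 2).Adj u v ↔ ((v 0 = u 0 + 1 ∨ u 0 = v 0 + 1) ∧ v 1 = u 1) ∨
      ((v 1 = u 1 + 1 ∨ u 1 = v 1 + 1) ∧ v 0 = u 0) := by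
  rw [zdGraph_adj_iff, Fin.exists_fin_two]
  simp only [funext_iff, Fin.forall_fin_two, Pi.add_apply, Pi.single_eq_same,
    Pi.single_eq_of_ne (one_ne_zero : (1 : Fin 2) ≠ 0),
    Pi.single_eq_of_ne (zero_ne_one : (0 : Fin 2) ≠ 1), add_zero]
  omega

/-- A site equals `st a b` iff its two coordinates are `a` and `b`. [folklore] -/
private theorem s4p201_eq_st_iff (v : Site 2) (a b : ℤ) : v = st a b ↔ v 0 = a ∧ v 1 = b :=
  ⟨fun h => h ▸ ⟨rfl, rfl⟩, fun h => by rw [← st_eta v, h.1, h.2]⟩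

/-- Adjacency of the strip `{0..n} × {0,1,2,3}` in coordinates. [folklore] -/
private theorem s4p201_adj_iff (n : ℕ) (u v : Site 2) :
    (discreteDomainGraph (rectDomain n 3) 1).Adj u v ↔
      (((v 0 = u 0 + 1 ∨ u 0 = v 0 + 1) ∧ v 1 = u 1) ∨ ((v 1 = u 1 + 1 ∨ u 1 = v 1 + 1) ∧ v 0 = u 0)) ∧
        ((0 ≤ u 0 ∧ u 0 ≤ n) ∧ (0 ≤ u 1 ∧ u 1 ≤ 3)) ∧ ((0 ≤ v 0 ∧ v 0 ≤ n) ∧ (0 ≤ v 1 ∧ v 1 ≤ 3)) := by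
  rw [adj_rect_iff, s4p201_zd_adj_iff, mem_rectSites_iff, mem_rectSites_iff, Nat.cast_ofNat]

/-- The sites of `S_L` are the sites of `S_{L+1}` off the new column `L+1`. [folklore] -/
private theorem s4p201_mem_old_iff (L : ℕ) (r0 r1 r2 r3 : ℤ)
    (hρ : (r0 = 0 ∧ r1 = 1 ∧ r2 = 2 ∧ r3 = 3) ∨ (r0 = 3 ∧ r1 = 2 ∧ r2 = 1 ∧ r3 = 0)) (u : Site 2) :
    u ∈ rectSites L 3 ↔ u ∈ rectSites (L + 1) 3 ∧
      (u ≠ st (L + 1 : ℕ) r2 ∧ u ≠ st (L + 1 : ℕ) r0 ∧ u ≠ st (L + 1 : ℕ) r1 ∧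
        u ≠ st (L + 1 : ℕ) r3) := by
  rw [mem_rectSites_iff, mem_rectSites_iff, Ne, Ne, Ne, Ne, s4p201_eq_st_iff, s4p201_eq_st_iff,
    s4p201_eq_st_iff, s4p201_eq_st_iff]
  omega

/-- The six edges of `S_{L+1}` used by the gluings, and the distinctness facts. [folklore] -/
private theorem s4p201_column (L : ℕ) (r0 r1 r2 r3 : ℤ)
    (hρ : (r0 = 0 ∧ r1 = 1 ∧ r2 = 2 ∧ r3 = 3) ∨ (r0 = 3 ∧ r1 = 2 ∧ r2 = 1 ∧ r3 = 0)) :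
    ((discreteDomainGraph (rectDomain (L + 1) 3) 1).Adj (st L r2) (st (L + 1 : ℕ) r2) ∧
      (discreteDomainGraph (rectDomain (L + 1) 3) 1).Adj (st L r3) (st (L + 1 : ℕ) r3) ∧
      (discreteDomainGraph (rectDomain (L + 1) 3) 1).Adj (st (L + 1 : ℕ) r3) (st (L + 1 : ℕ) r2) ∧
      (discreteDomainGraph (rectDomain (L + 1) 3) 1).Adj (st (L + 1 : ℕ) r0) (st (L + 1 : ℕ) r1) ∧
      (discreteDomainGraph (rectDomain (L + 1) 3) 1).Adj (st (L + 1 : ℕ) r0) (st L r0) ∧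
      (discreteDomainGraph (rectDomain (L + 1) 3) 1).Adj (st L r1) (st (L + 1 : ℕ) r1)) ∧
    (st L r2 ≠ st (L + 1 : ℕ) r3 ∧ st (L + 1 : ℕ) r2 ≠ st (L + 1 : ℕ) r0 ∧
      st (L + 1 : ℕ) r2 ≠ st (L + 1 : ℕ) r1 ∧ st (L + 1 : ℕ) r0 ≠ st (L + 1 : ℕ) r3 ∧
      st (L + 1 : ℕ) r1 ≠ st (L + 1 : ℕ) r3) := by
  refine ⟨⟨?_, ?_, ?_, ?_, ?_, ?_⟩, ?_⟩
  · rw [s4p201_adj_iff]; dsimp only [st_zero, st_one]; omega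
  · rw [s4p201_adj_iff]; dsimp only [st_zero, st_one]; omega
  · rw [s4p201_adj_iff]; dsimp only [st_zero, st_one]; omega
  · rw [s4p201_adj_iff]; dsimp only [st_zero, st_one]; omega
  · rw [s4p201_adj_iff]; dsimp only [st_zero, st_one]; omega
  · rw [s4p201_adj_iff]; dsimp only [st_zero, st_one]; omega
  · rw [Ne, Ne, Ne, Ne, Ne, s4p201_eq_st_iff, s4p201_eq_st_iff, s4p201_eq_st_iff, s4p201_eq_st_iff,
      s4p201_eq_st_iff]
    dsimp only [st_zero, st_one]; omega

/-- The neighbours, in `S_{L+1}`, of the four sites of its last column. [folklore] -/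
private theorem s4p201_nbrs (L : ℕ) (r0 r1 r2 r3 : ℤ)
    (hρ : (r0 = 0 ∧ r1 = 1 ∧ r2 = 2 ∧ r3 = 3) ∨ (r0 = 3 ∧ r1 = 2 ∧ r2 = 1 ∧ r3 = 0)) :
    (∀ u, (discreteDomainGraph (rectDomain (L + 1) 3) 1).Adj (st (L + 1 : ℕ) r2) u →
        u = st L r2 ∨ u = st (L + 1 : ℕ) r1 ∨ u = st (L + 1 : ℕ) r3) ∧
      (∀ u, (discreteDomainGraph (rectDomain (L + 1) 3) 1).Adj (st (L + 1 : ℕ) r3) u →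
        u = st L r3 ∨ u = st (L + 1 : ℕ) r2) ∧
      (∀ u, (discreteDomainGraph (rectDomain (L + 1) 3) 1).Adj (st (L + 1 : ℕ) r0) u →
        u = st L r0 ∨ u = st (L + 1 : ℕ) r1) ∧
      (∀ u, (discreteDomainGraph (rectDomain (L + 1) 3) 1).Adj (st (L + 1 : ℕ) r1) u →
        u = st L r1 ∨ u = st (L + 1 : ℕ) r0 ∨ u = st (L + 1 : ℕ) r2) := by
  refine ⟨fun u h => ?_, fun u h => ?_, fun u h => ?_, fun u h => ?_⟩
  · rw [s4p201_adj_iff] at h; rw [s4p201_eq_st_iff, s4p201_eq_st_iff, s4p201_eq_st_iff]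
    dsimp only [st_zero, st_one] at h; omega
  · rw [s4p201_adj_iff] at h; rw [s4p201_eq_st_iff, s4p201_eq_st_iff]; dsimp only [st_zero, st_one] at h; omega
  · rw [s4p201_adj_iff] at h; rw [s4p201_eq_st_iff, s4p201_eq_st_iff]; dsimp only [st_zero, st_one] at h; omega
  · rw [s4p201_adj_iff] at h; rw [s4p201_eq_st_iff, s4p201_eq_st_iff, s4p201_eq_st_iff]
    dsimp only [st_zero, st_one] at h; omega

open Classical in
/-- STUB W4-C3 (`stub_strip4_recPair201`). Recursion of the disjoint-pair kernel (main path to `(L+1,ρ₂)`, loop `(L+1,ρ₀) → (L+1,ρ₁)`): the loop is the rung or dips into `S_L`. [folklore] -/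
theorem stub_strip4_recPair201 (L : ℕ) {x : ℝ} (hx : 0 ≤ x) (r : ℤ) (hr : 0 ≤ r ∧ r ≤ 3) (r0 r1 r2 r3 : ℤ)
    (hρ : (r0 = 0 ∧ r1 = 1 ∧ r2 = 2 ∧ r3 = 3) ∨ (r0 = 3 ∧ r1 = 2 ∧ r2 = 1 ∧ r3 = 0)) :
    (∑' (γ : (discreteDomainGraph (rectDomain (L + 1) 3) 1).Path (st 0 r) (st (L + 1 : ℕ) r2))
        (γ' : (discreteDomainGraph (rectDomain (L + 1) 3) 1).Path (st (L + 1 : ℕ) r0) (st (L + 1 : ℕ) r1)),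
      (if List.Disjoint γ.1.support γ'.1.support then
        ENNReal.ofReal (x ^ γ.1.length) * ENNReal.ofReal (x ^ γ'.1.length) else 0)) =
      ENNReal.ofReal (x ^ 2) * pathKernel (discreteDomainGraph (rectDomain L 3) 1) x (st 0 r) (st L r2) +
        ENNReal.ofReal (x ^ 3) * pathKernel (discreteDomainGraph (rectDomain L 3) 1) x (st 0 r) (st L r3) +
        ENNReal.ofReal (x ^ 3) *
          (∑' (γ : (discreteDomainGraph (rectDomain L 3) 1).Path (st 0 r) (st L r2))
              (γ' : (discreteDomainGraph (rectDomain L 3) 1).Path (st L r0) (st L r1)),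
            (if List.Disjoint γ.1.support γ'.1.support then
              ENNReal.ofReal (x ^ γ.1.length) * ENNReal.ofReal (x ^ γ'.1.length) else 0)) +
        ENNReal.ofReal (x ^ 4) *
          (∑' (γ : (discreteDomainGraph (rectDomain L 3) 1).Path (st 0 r) (st L r3))
              (γ' : (discreteDomainGraph (rectDomain L 3) 1).Path (st L r0) (st L r1)),
            (if List.Disjoint γ.1.support γ'.1.support then
              ENNReal.ofReal (x ^ γ.1.length) * ENNReal.ofReal (x ^ γ'.1.length) else 0)) := by
  obtain ⟨⟨hpt, hp3m3, hm3t, hm0m1, hm0p0, hp1m1⟩, hps, ht0, ht1, h03, h13⟩ := s4p201_column L r0 r1 r2 r3 hρ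
  obtain ⟨hNt, hNm3, hNm0, hNm1⟩ := s4p201_nbrs L r0 r1 r2 r3 hρ
  have ha : st 0 r ∈ rectSites L 3 := by rw [mem_rectSites_iff, st_zero, st_one]; omega
  have hp0 : st (L : ℤ) r0 ∈ rectSites L 3 := by rw [mem_rectSites_iff, st_zero, st_one]; omega
  exact s4p201_abstract x hx
    (fun u v h => by
      rw [adj_rect_iff] at h ⊢
      exact ⟨h.1, ((s4p201_mem_old_iff L r0 r1 r2 r3 hρ u).1 h.2.1).1,
        ((s4p201_mem_old_iff L r0 r1 r2 r3 hρ v).1 h.2.2).1⟩)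
    (fun u v h hu hv => by
      rw [adj_rect_iff] at h ⊢
      exact ⟨h.1, (s4p201_mem_old_iff L r0 r1 r2 r3 hρ u).2 ⟨h.2.1, hu⟩,
        (s4p201_mem_old_iff L r0 r1 r2 r3 hρ v).2 ⟨h.2.2, hv⟩⟩)
    (fun u v h => ((s4p201_mem_old_iff L r0 r1 r2 r3 hρ v).1 (adj_rect_iff.1 h).2.2).2)
    ((s4p201_mem_old_iff L r0 r1 r2 r3 hρ _).1 ha).2 ((s4p201_mem_old_iff L r0 r1 r2 r3 hρ _).1 hp0).2
    hps hpt hp3m3 hm3t hm0m1 hm0p0 hp1m1 hNt hNm3 hNm0 hNm1 ht0 ht1 h03 h13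

end Summit.CriticalPhenomena.SAWScalingLimit.Theorems.BoundaryTP2
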